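import Summits.HodgeConjecture.HodgeConjecture.Theorems.MarkmanPartnerTransportPicardThreeK3SquaresHodgeSimilitudeAlgebraic
import Summits.HodgeConjecture.HodgeConjecture.Theorems.MarkmanPartnerTransportPicardThreeK3SquaresQuotientDescentIff
import Summits.HodgeConjecture.HodgeConjecture.Theorems.MarkmanPartnerTransportPicardThreeK3SquaresSymplecticLocus

/-!
# Route MarkmanPartnerTransport · crux `PicardThreeK3Squares` (stmt-HodgeConjecture-19652) —
# SIMILITUDE INVARIANCE: HC⁴ for K3 squares is an invariant of rational Hodge similitudes of multiplier
# `2` (`ρ ≥ 11`) and `3` (`ρ ≥ 15`), not only of isogenies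

Composition of gen 5's three pieces: `…HodgeSimilitudeAlgebraic` (Varesco Thm 0.2 in the kernel: a
rational Hodge similitude `ψ : T(Y) ↠ T(X)` of multiplier `2` (`ρ(X) ≥ 11`) / `3` (`ρ(X) ≥ 15`) is
`[γ']_*` on `T(Y)` for an algebraic `γ'` on `X ⊗ Y`), the transcendental projector
`Q = [γ_Q]_*` of `Y` (`SymplecticLocus.exists_corr_transcendentalProjector`: algebraic, kills `N¹(Y)`,
identity on `T(Y)`), and `…QuotientDescentIff` (HC⁴ is invariant along an algebraic similitude DATUM).
If `ψ` is given as a rational, Hodge-type preserving map `H²(Y) → H²(X)` killing `N¹(Y)` (the usual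
normal form of a transcendental Hodge morphism), then `[γ' ∘ γ_Q]_* = ψ ∘ Q = ψ` on ALL of `H²(Y)`, so
`γ' ∘ γ_Q` is a datum for `X` from `Y`, and:

* `exists_datum_of_similitude_two` / `…_three` — such a `ψ` IS the action of an algebraic class (globally).
* `hodgeConjectureFor_square_iff_of_similitude_two` (`ρ(X) ≥ 11`) / `…_three` (`ρ(X) ≥ 15`) /
  `…_two_of_embedding` (any `ρ(X)`, given `T(X)_ℚ ↪ (U³ ⊕ E₈(−2)) ⊗ ℚ`) —
  **HC⁴(Y ⊗ Y) ⟺ HC⁴(X ⊗ X) for marked projective K3 surfaces related by a rational Hodge similitude of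
  multiplier `2` resp. `3`**, modulo `Buskin2019_hodgeIsometry_algebraic` and
  `Varesco2023_quotientSimilitude_two/three_of_transcendental_embedding`. (Isometries: gen 3's
  `…IsogenyInvariance`, mod Buskin.) So the open residue of the crux is a union of SIMILITUDE classes.

No definition, no sorry. Prover seat hodge-nonav-19652-p1 (gen 5), `--supports stmt-HodgeConjecture-19652`.

References: M. Varesco, Math. Z. 305 (2023) Thm. 0.2, §2; D. Huybrechts, Comment. Math. Helv. 94 (2019)
Thm. 0.2 (isogenies); W. Fulton, *Intersection theory*, §16.1.
-/

set_option linter.dupNamespace false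

noncomputable section

namespace Summit.HodgeConjecture.HodgeConjecture.Theorems.MarkmanPartnerTransport.QuotientSimilitude

open scoped Manifold
open Module CategoryTheory MonoidalCategory CartesianMonoidalCategory
open Literature.AlgebraicGeometry Literature.AlgebraicGeometry.Motives Literature.AlgebraicGeometry.HodgeTheory
open Literature.AlgebraicGeometry.Surfaces
open Literature.AlgebraicTopology.SingularHomology
open Summit.HodgeConjecture.HodgeConjecture.Theorems
open Summit.HodgeConjecture.HodgeConjecture.Theorems.NikulinTwinTransport
open Summit.HodgeConjecture.HodgeConjecture.Theorems.MarkmanPartnerTransport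
open Summit.HodgeConjecture.HodgeConjecture.Theorems.MarkmanPartnerTransport.SimilitudeTranspose

variable {S Y : SchemeOver ℂ}

/-- `MarkedK3[S, η, p, x]`: VERBATIM the `let MarkedK3 := …` binder of the route declaration
`PicardThreeK3Squares`. Local notation only. -/
local notation3 (prettyPrint := false) "MarkedK3[" S ", " η ", " p ", " x "]" =>
  (p ≠ 0 ∧ (IsIntegralClass p ∧
    (∀ q : complexBetti S (2 * 2), IsIntegralClass q → ∃ n : ℤ, q = n • p) ∧
    (∀ c : complexBetti S (2 * 1), IsIntegralClass c ↔ ∃ v : K3Index → ℤ, η c = fun i => (v i : ℂ)) ∧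
    (∀ a b : complexBetti S (2 * 1),
      cupProduct (rfl : 2 * 1 + 2 * 1 = 2 * 2) a b = k3Form (η a) (η b) • p) ∧
    IsOfHodgeType 2 S (2 * 1) 2 0 (LinearEquiv.symm η x) ∧
    (∀ τ : complexBetti S (2 * 1), IsOfHodgeType 2 S (2 * 1) 2 0 τ →
      ∃ t : ℂ, τ = t • LinearEquiv.symm η x)) ∧
    (k3Form x x = 0 ∧ 0 < (k3Form (star x) x).re ∧
      ∃ u : K3Index → ℤ, k3Form (fun i => (u i : ℂ)) x = 0 ∧ 0 < ∑ i, ∑ j, u i * k3Gram i j * u j))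

/-- `Corr[μ, X, Y, hX, hY ; γ, y] = fst_* (snd^* y ∪ γ)` (`hX hY : IsSmoothProjective 2 _`). Local notation only. -/
local notation3 (prettyPrint := false) "Corr[" μ ", " X ", " Y ", " hX ", " hY " ; " γ ", " y "]" =>
  complexGysin μ (IsSmoothProjective.tensor_holds hX hY) hX (SemiCartesianMonoidalCategory.fst X Y)
    (rfl : 2 * 1 + 2 * 2 + 2 * 2 = 2 * 1 + 2 * (2 + 2))
    (cupProduct (rfl : 2 * 1 + 2 * 2 = 2 * 1 + 2 * 2)
      (complexBetti.map (SemiCartesianMonoidalCategory.snd X Y) (2 * 1) y) γ)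

/-- `Transp[X, Y ; γ] = swap^* γ`. Local notation only. -/
local notation3 (prettyPrint := false) "Transp[" X ", " Y " ; " γ "]" =>
  complexBetti.map (CartesianMonoidalCategory.lift (SemiCartesianMonoidalCategory.snd Y X)
    (SemiCartesianMonoidalCategory.fst Y X)) (2 * 2) γ

/-- `Datum[X, Z, hX, hZ, η, ηZ ; γ, m]`: `γ` is an algebraic class on `X ⊗ Z` whose action `[γ]_*` is
rational, Hodge-type preserving, maps `T(Z)` onto `T(X)` and scales the forms there by `m` in the
markings. Local notation only. -/
local notation3 (prettyPrint := false) "Datum[" X ", " Z ", " hX ", " hZ ", " η ", " ηZ " ; " γ ", " m "]" =>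
  (γ ∈ algebraicClasses (X ⊗ Z) 2 ∧
    (∀ y, IsRationalClass y → IsRationalClass (Corr[complexOrientationFamily, X, Z, hX, hZ ; γ, y])) ∧
    (∀ (i j : ℕ) y, IsOfHodgeType 2 Z (2 * 1) i j y →
      IsOfHodgeType 2 X (2 * 1) i j (Corr[complexOrientationFamily, X, Z, hX, hZ ; γ, y])) ∧
    (∀ y ∈ transcendentalSubspace Z,
      Corr[complexOrientationFamily, X, Z, hX, hZ ; γ, y] ∈ transcendentalSubspace X) ∧
    (∀ z ∈ transcendentalSubspace X, ∃ y ∈ transcendentalSubspace Z,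
      Corr[complexOrientationFamily, X, Z, hX, hZ ; γ, y] = z) ∧
    (∀ a ∈ transcendentalSubspace Z, ∀ b ∈ transcendentalSubspace Z,
      k3Form (η (Corr[complexOrientationFamily, X, Z, hX, hZ ; γ, a]))
        (η (Corr[complexOrientationFamily, X, Z, hX, hZ ; γ, b])) = m * k3Form (ηZ a) (ηZ b)))

/-! ### From a correspondence acting as `ψ` on `T(Y)` to one acting as `ψ` everywhere -/

/-- **If an algebraic class acts as `ψ` on `T(Y)` and `ψ` kills `N¹(Y)`, then some algebraic class acts as
`ψ` on all of `H²(Y)`**: compose with the transcendental projector `Q = [γ_Q]_*` of `Y` (algebraic, `Q = 0`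
on `N¹(Y)`, `Q = id` on `T(Y)`; `H² = N¹ + T`). [cite: Varesco2023, §2 (p. 8)] [cite: Fulton1998, §16.1 Prop. 16.1.1] -/
theorem exists_corr_eq_of_eq_on_transcendental (hS : IsK3Surface S) (hY : IsK3Surface Y)
    (ψ : complexBetti Y (2 * 1) →ₗ[ℂ] complexBetti S (2 * 1)) (hψN : ∀ d ∈ algebraicClasses Y 1, ψ d = 0)
    {γ : complexBetti (S ⊗ Y) (2 * 2)} (hγalg : γ ∈ algebraicClasses (S ⊗ Y) 2)
    (hγ : ∀ y ∈ transcendentalSubspace Y, Corr[complexOrientationFamily, S, Y, hS.1, hY.1 ; γ, y] = ψ y) :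
    ∃ γ' ∈ algebraicClasses (S ⊗ Y) 2, ∀ y, Corr[complexOrientationFamily, S, Y, hS.1, hY.1 ; γ', y] = ψ y := by
  have h4 : 2 * 1 + 2 * 1 = 2 * 2 := rfl
  obtain ⟨Q, γQ, hγQalg, hQ, hQN, hQT⟩ :=
    SymplecticLocus.exists_corr_transcendentalProjector complexOrientationFamily hY.1
  have hCUP := SquareOfGenerator.cupProduct_mem_algebraicClasses_tripleProduct
  obtain ⟨γ', hγ'alg, hγ'⟩ := corrComp_K3_of_cup complexOrientationFamily hCUP S Y Y hS hY hY γ hγalg γQ hγQalg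
  refine ⟨γ', hγ'alg, fun y ↦ ?_⟩
  obtain ⟨n, hn, hT⟩ := exists_algebraic_add_transcendental hY.1 y
  have hQy : Q y = y - n := by
    have h1 : Q (y - n) = y - n :=
      hQT _ ((mem_transcendentalSubspace_iff_forall_algebraicClasses hY.1 _).1 hT)
    rw [map_sub, hQN n hn, sub_zero] at h1
    exact h1
  rw [hγ' y, ← hQ y, hQy, hγ _ hT, map_sub, hψN n hn, sub_zero]

/-! ### Similitude invariance of HC⁴, multiplier `2` and `3` -/

/-- **HC⁴(Y ⊗ Y) ⟺ HC⁴(X ⊗ X) along a rational Hodge similitude of multiplier `2`, `ρ(X) ≥ 11`.** Data: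
marked projective K3 surfaces `(X, η, p, x)` (`ρ(X) ≥ 11`), `(Y, η_Y, p_Y, x_Y)`, and
`ψ : H²(Y(ℂ); ℂ) → H²(X(ℂ); ℂ)` rational, Hodge-type preserving, killing `N¹(Y)`, mapping `T(Y)` onto
`T(X)` with `(ηψa · ηψb) = 2 (η_Y a · η_Y b)` there and `ψ(η_Y⁻¹x_Y) ∈ ℂ·η⁻¹x`. Modulo
`Buskin2019_hodgeIsometry_algebraic` and `Varesco2023_quotientSimilitude_two_of_transcendental_embedding`:
`ψ = [γ']_*` on `T(Y)` (`algebraic_of_similitude_two_of_eleven_le`), hence everywhere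
(`exists_corr_eq_of_eq_on_transcendental`), so `γ'` is a datum and `hodgeConjectureFor_square_iff_of_datum`
applies. [cite: Varesco2023, Thm. 0.2 and §2] [cite: Buskin2019, Thm. 1.1] -/
theorem hodgeConjectureFor_square_iff_of_similitude_two (hB : Buskin2019_hodgeIsometry_algebraic)
    (hQ2 : Varesco2023_quotientSimilitude_two_of_transcendental_embedding) (hS : IsK3Surface S)
    (η : complexBetti S (2 * 1) ≃ₗ[ℂ] (K3Index → ℂ)) (p : complexBetti S (2 * 2)) (x : K3Index → ℂ)
    (hM : MarkedK3[S, η, p, x]) (hρ : 11 ≤ Module.finrank ℂ ↥(algebraicClasses S 1))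
    (hY : IsK3Surface Y)
    (ηY : complexBetti Y (2 * 1) ≃ₗ[ℂ] (K3Index → ℂ)) (pY : complexBetti Y (2 * 2)) (xY : K3Index → ℂ)
    (hMY : MarkedK3[Y, ηY, pY, xY])
    (ψ : complexBetti Y (2 * 1) →ₗ[ℂ] complexBetti S (2 * 1))
    (hψrat : ∀ y, IsRationalClass y → IsRationalClass (ψ y))
    (hψtyp : ∀ (i j : ℕ) y, IsOfHodgeType 2 Y (2 * 1) i j y → IsOfHodgeType 2 S (2 * 1) i j (ψ y))
    (hψN : ∀ d ∈ algebraicClasses Y 1, ψ d = 0)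
    (hψT : ∀ y ∈ transcendentalSubspace Y, ψ y ∈ transcendentalSubspace S)
    (hψonto : ∀ z ∈ transcendentalSubspace S, ∃ y ∈ transcendentalSubspace Y, ψ y = z)
    (hψmul : ∀ a ∈ transcendentalSubspace Y, ∀ b ∈ transcendentalSubspace Y,
      k3Form (η (ψ a)) (η (ψ b)) = 2 * k3Form (ηY a) (ηY b))
    (hψline : ∃ t : ℂ, ψ (ηY.symm xY) = t • η.symm x) :
    HodgeConjectureFor 4 (Y ⊗ Y) ↔ HodgeConjectureFor 4 (S ⊗ S) := by
  obtain ⟨γ₀, hγ₀alg, hγ₀⟩ := algebraic_of_similitude_two_of_eleven_le hB hQ2 hS η p x hM hρ hY ηY pY xY hMY ψ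
    hψT hψonto (fun y _ hy ↦ hψrat y hy) hψmul hψline
  obtain ⟨γ', hγ'alg, hγ'⟩ := exists_corr_eq_of_eq_on_transcendental hS hY ψ hψN hγ₀alg hγ₀
  refine hodgeConjectureFor_square_iff_of_datum hS η p x hM hY ηY pY xY hMY (m := 2) two_ne_zero ⟨2, by norm_num⟩ γ'
    ⟨hγ'alg, fun y hy ↦ by rw [hγ']; exact hψrat y hy, fun i j y hy ↦ by rw [hγ']; exact hψtyp i j y hy,
      fun y hy ↦ by rw [hγ']; exact hψT y hy,
      fun z hz ↦ by
        obtain ⟨y, hy, hyz⟩ := hψonto z hz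
        exact ⟨y, hy, by rw [hγ']; exact hyz⟩,
      fun a ha b hb ↦ by rw [hγ', hγ']; exact hψmul a ha b hb⟩

/-- **HC⁴(Y ⊗ Y) ⟺ HC⁴(X ⊗ X) along a rational Hodge similitude of multiplier `3`, `ρ(X) ≥ 15`**, modulo
`Buskin2019_hodgeIsometry_algebraic` and `Varesco2023_quotientSimilitude_three_of_transcendental_embedding`
(same data and proof with `algebraic_of_similitude_three_of_fifteen_le`). [cite: Varesco2023, Thm. 0.2 and §2]
[cite: Buskin2019, Thm. 1.1] -/
theorem hodgeConjectureFor_square_iff_of_similitude_three (hB : Buskin2019_hodgeIsometry_algebraic)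
    (hQ3 : Varesco2023_quotientSimilitude_three_of_transcendental_embedding) (hS : IsK3Surface S)
    (η : complexBetti S (2 * 1) ≃ₗ[ℂ] (K3Index → ℂ)) (p : complexBetti S (2 * 2)) (x : K3Index → ℂ)
    (hM : MarkedK3[S, η, p, x]) (hρ : 15 ≤ Module.finrank ℂ ↥(algebraicClasses S 1))
    (hY : IsK3Surface Y)
    (ηY : complexBetti Y (2 * 1) ≃ₗ[ℂ] (K3Index → ℂ)) (pY : complexBetti Y (2 * 2)) (xY : K3Index → ℂ)
    (hMY : MarkedK3[Y, ηY, pY, xY])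
    (ψ : complexBetti Y (2 * 1) →ₗ[ℂ] complexBetti S (2 * 1))
    (hψrat : ∀ y, IsRationalClass y → IsRationalClass (ψ y))
    (hψtyp : ∀ (i j : ℕ) y, IsOfHodgeType 2 Y (2 * 1) i j y → IsOfHodgeType 2 S (2 * 1) i j (ψ y))
    (hψN : ∀ d ∈ algebraicClasses Y 1, ψ d = 0)
    (hψT : ∀ y ∈ transcendentalSubspace Y, ψ y ∈ transcendentalSubspace S)
    (hψonto : ∀ z ∈ transcendentalSubspace S, ∃ y ∈ transcendentalSubspace Y, ψ y = z)
    (hψmul : ∀ a ∈ transcendentalSubspace Y, ∀ b ∈ transcendentalSubspace Y,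
      k3Form (η (ψ a)) (η (ψ b)) = 3 * k3Form (ηY a) (ηY b))
    (hψline : ∃ t : ℂ, ψ (ηY.symm xY) = t • η.symm x) :
    HodgeConjectureFor 4 (Y ⊗ Y) ↔ HodgeConjectureFor 4 (S ⊗ S) := by
  obtain ⟨γ₀, hγ₀alg, hγ₀⟩ := algebraic_of_similitude_three_of_fifteen_le hB hQ3 hS η p x hM hρ hY ηY pY xY hMY ψ
    hψT hψonto (fun y _ hy ↦ hψrat y hy) hψmul hψline
  obtain ⟨γ', hγ'alg, hγ'⟩ := exists_corr_eq_of_eq_on_transcendental hS hY ψ hψN hγ₀alg hγ₀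
  refine hodgeConjectureFor_square_iff_of_datum hS η p x hM hY ηY pY xY hMY (m := 3) three_ne_zero ⟨3, by norm_num⟩ γ'
    ⟨hγ'alg, fun y hy ↦ by rw [hγ']; exact hψrat y hy, fun i j y hy ↦ by rw [hγ']; exact hψtyp i j y hy,
      fun y hy ↦ by rw [hγ']; exact hψT y hy,
      fun z hz ↦ by
        obtain ⟨y, hy, hyz⟩ := hψonto z hz
        exact ⟨y, hy, by rw [hγ']; exact hyz⟩,
      fun a ha b hb ↦ by rw [hγ', hγ']; exact hψmul a ha b hb⟩

/-! ### Any Picard rank, under the lattice criterion (similitude saturation of every sector) -/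

/-- **HC⁴(Y ⊗ Y) ⟺ HC⁴(X ⊗ X) along a rational Hodge similitude of multiplier `2`, at ANY Picard rank,
for `X` with `T(X)_ℚ ↪ (U³ ⊕ E₈(−2)) ⊗ ℚ`** (isometric embedding `ι` of the transcendental coordinate
vectors into `⟨1,1,1⟩ ⊕ ⟨−1⟩¹¹`, injective there — Varesco Prop. 2.5), modulo
`Buskin2019_hodgeIsometry_algebraic` and `Varesco2023_quotientSimilitude_two_of_transcendental_embedding`.
Consequence by name: every sector of the crux (e.g. the cycle-induced RM surfaces of
`SquareOfGenerator`) propagates to its `2`-similitude saturation inside the Nikulin lattice locus.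
[cite: Varesco2023, Thm. 0.2, §2 and Prop. 2.5] [cite: Buskin2019, Thm. 1.1] -/
theorem hodgeConjectureFor_square_iff_of_similitude_two_of_embedding (hB : Buskin2019_hodgeIsometry_algebraic)
    (hQ2 : Varesco2023_quotientSimilitude_two_of_transcendental_embedding) (hS : IsK3Surface S)
    (η : complexBetti S (2 * 1) ≃ₗ[ℂ] (K3Index → ℂ)) (p : complexBetti S (2 * 2)) (x : K3Index → ℂ)
    (hM : MarkedK3[S, η, p, x])
    (ι : (K3Index → ℚ) →ₗ[ℚ] (Fin 14 → ℚ))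
    (hiso : ∀ v w : K3Index → ℚ, IsTranscendentalCoord S η v → IsTranscendentalCoord S η w →
      ∑ i : Fin 14, (![1, 1, 1, -1, -1, -1, -1, -1, -1, -1, -1, -1, -1, -1] : Fin 14 → ℚ) i * ι v i * ι w i =
        k3FormRat v w)
    (hinj : ∀ v : K3Index → ℚ, IsTranscendentalCoord S η v → ι v = 0 → v = 0)
    (hY : IsK3Surface Y)
    (ηY : complexBetti Y (2 * 1) ≃ₗ[ℂ] (K3Index → ℂ)) (pY : complexBetti Y (2 * 2)) (xY : K3Index → ℂ)
    (hMY : MarkedK3[Y, ηY, pY, xY])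
    (ψ : complexBetti Y (2 * 1) →ₗ[ℂ] complexBetti S (2 * 1))
    (hψrat : ∀ y, IsRationalClass y → IsRationalClass (ψ y))
    (hψtyp : ∀ (i j : ℕ) y, IsOfHodgeType 2 Y (2 * 1) i j y → IsOfHodgeType 2 S (2 * 1) i j (ψ y))
    (hψN : ∀ d ∈ algebraicClasses Y 1, ψ d = 0)
    (hψT : ∀ y ∈ transcendentalSubspace Y, ψ y ∈ transcendentalSubspace S)
    (hψonto : ∀ z ∈ transcendentalSubspace S, ∃ y ∈ transcendentalSubspace Y, ψ y = z)
    (hψmul : ∀ a ∈ transcendentalSubspace Y, ∀ b ∈ transcendentalSubspace Y,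
      k3Form (η (ψ a)) (η (ψ b)) = 2 * k3Form (ηY a) (ηY b))
    (hψline : ∃ t : ℂ, ψ (ηY.symm xY) = t • η.symm x) :
    HodgeConjectureFor 4 (Y ⊗ Y) ↔ HodgeConjectureFor 4 (S ⊗ S) := by
  obtain ⟨hp₀, ⟨hpint, hpgen, hηint, hηcup, -, -⟩, -⟩ := id hM
  obtain ⟨Z, hZ, ηZ, pZ, xZ, hMZ, φ, γ, hγalg, hφ, hφrat, hφtyp, hφT, hφonto, hφmul⟩ :=
    hQ2 hS η p hp₀ hpint hpgen hηint hηcup ι hiso hinj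
  obtain ⟨γ₀, hγ₀alg, hγ₀⟩ := algebraic_of_similitude_of_datum hB hS η p x hM hY ηY pY xY hMY hZ ηZ pZ xZ hMZ
    (m := 2) two_ne_zero γ
    ⟨hγalg, fun y hy ↦ by rw [← hφ]; exact hφrat y hy, fun i j y hy ↦ by rw [← hφ]; exact hφtyp i j y hy,
      fun y hy ↦ by rw [← hφ]; exact hφT y hy,
      fun z hz ↦ by
        obtain ⟨y, hy, hyz⟩ := hφonto z hz
        exact ⟨y, hy, by rw [← hφ]; exact hyz⟩,
      fun a ha b hb ↦ by rw [← hφ, ← hφ, Nat.cast_ofNat]; exact hφmul a ha b hb⟩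
    ψ hψT hψonto (fun y _ hy ↦ hψrat y hy) (fun a ha b hb ↦ by rw [Nat.cast_ofNat]; exact hψmul a ha b hb) hψline
  obtain ⟨γ', hγ'alg, hγ'⟩ := exists_corr_eq_of_eq_on_transcendental hS hY ψ hψN hγ₀alg hγ₀
  refine hodgeConjectureFor_square_iff_of_datum hS η p x hM hY ηY pY xY hMY (m := 2) two_ne_zero ⟨2, by norm_num⟩ γ'
    ⟨hγ'alg, fun y hy ↦ by rw [hγ']; exact hψrat y hy, fun i j y hy ↦ by rw [hγ']; exact hψtyp i j y hy,
      fun y hy ↦ by rw [hγ']; exact hψT y hy,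
      fun z hz ↦ by
        obtain ⟨y, hy, hyz⟩ := hψonto z hz
        exact ⟨y, hy, by rw [hγ']; exact hyz⟩,
      fun a ha b hb ↦ by rw [hγ', hγ']; exact hψmul a ha b hb⟩

end Summit.HodgeConjecture.HodgeConjecture.Theorems.MarkmanPartnerTransport.QuotientSimilitude

end
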